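import Summits.RiemannHypothesis.RiemannHypothesis.Theorems.SignConeSignConeOscillatoryIffInequality

/-!
# The coherent core carries the whole oscillatory crux
(route `SignCone`, item stmt-RiemannHypothesis-16302 `SignConeOscillatory`; rev 4–5 children
`OscCoherentCore` = stmt-RiemannHypothesis-18013 and `OscSingleWindow` = stmt-RiemannHypothesis-18012)

Rev 4–5 of the route consumes the oscillatory crux `SignConeOscillatory` through three regimes:
the certified rung `OscUpToThirteenTenths` (`a ≤ 13/10`, landed), the single high window
`OscSingleWindow` (far-field negativity confined to ONE window `T ≤ |t| ≤ T + log 2`, `T ≥ 3`) and the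
complement `OscCoherentCore` (`a > 13/10`, negativity NOT confined to a single such window). The route's
honest label says the core "carries the whole RH-strength content" of the crux; this file makes that a
kernel-checked statement:

* `signConeInequality_of_oscCoherentCore : OscCoherentCore → SignConeInequality` — the core ALONE implies the
  whole unit-slack sign-cone inequality (the route's target, item stmt-RiemannHypothesis-16301), hence the
  oscillatory crux (`signConeOscillatory_of_oscCoherentCore`) and its sibling `OscSingleWindow`
  (`oscSingleWindow_of_oscCoherentCore`); with the trivial restriction
  `oscCoherentCore_of_signConeOscillatory` this gives `oscCoherentCore_iff_signConeOscillatory` and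
  `oscCoherentCore_iff_signConeInequality`.

Mechanism (the collapse pattern of `signConeInequality_of_signConeOscillatory`, run twice): given a
node-nonnegative `F = Σᵢ gᵢ ⋆ g̃ᵢ` at cutoff `a`, append TWO vanishing two-bump oscillations
`η wⱼ = η (φⱼ(· + cⱼ/2) - φⱼ(· - cⱼ/2))`, `j = 1, 2`, placed in node gaps beyond the support of `F` at heights
`c₁ > 2a` and `c₂ > c₁ + 2ρ₁ + log 2 + 13/5`. The kernel `F + η² G₁ + η² G₂` (`Gⱼ = wⱼ ⋆ w̃ⱼ`) lies in the
cone at the cutoff `a' = c₂/2 + ρ₂ > 13/10`, is node-nonnegative (`Gⱼ(log m) = 0`), is negative at `c₁` AND at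
`c₂` (`Re Gⱼ(cⱼ) = -∫ φⱼ² < 0`, the other two summands vanish there), and `c₂ - c₁ > log 2` rules out every
single window `[T, T + log 2]` — so it is in the coherent-core class. `OscCoherentCore` at `a'`, linearity of
`W_ar = weilPolarTerm + weilArchTerm` and `η → 0` give `-Re F(0) ≤ Re W_ar(F)`.

Consequences for the route (rev 5 `closes hR hS hC hD hM h₃ h₄`): the hypotheses `hR : OscUpToThirteenTenths`
and `hS : OscSingleWindow` are implied by `hC : OscCoherentCore` (so is `h₄ : SignConeFarField`); the
three-regime case analysis isolates nothing from the core, exactly as the route's HONEST LABEL and the crux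
strategist's census (§1.D1/D2, "presence-type class splits collapse") predicted. `OscSingleWindow` remains a
meaningful SUPPORT target (the incoherent regime where the lattice-chirp lever is claimed to bite), but it
is not load-bearing for `closes`.
-/

noncomputable section

-- `Summit.RiemannHypothesis.RiemannHypothesis.…` repeats a namespace component by design (D-0017 layout).
set_option linter.dupNamespace false

open scoped BigOperators ComplexConjugate Topology
open Complex MeasureTheory Set Filter

namespace Summit.RiemannHypothesis.RiemannHypothesis.Theorems.SignCone

open Literature.NumberTheory.LFunctions
open Summit.RiemannHypothesis.RiemannHypothesis.Theorems.RuelleBandCofiniteCriticalLine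
open Summit.RiemannHypothesis.RiemannHypothesis.Theses.SignCone

/-! ## Appending one scaled summand to a family of tests -/

/-- Appending the summand `η w` to the family `g` adds `η² (w ⋆ w̃)` to the autocorrelation sum. [folklore] -/
theorem sum_weilConv_snoc_const_mul_apply {k : ℕ} (g : Fin k → ℝ → ℂ) (w : ℝ → ℂ) (η t : ℝ) :
    (∑ i, weilConv (Fin.snoc (α := fun _ => ℝ → ℂ) g (fun u => (η : ℂ) * w u) i)
        (weilReflect (Fin.snoc (α := fun _ => ℝ → ℂ) g (fun u => (η : ℂ) * w u) i)) t) =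
      (∑ i, weilConv (g i) (weilReflect (g i)) t) + ((η ^ 2 : ℝ) : ℂ) * weilConv w (weilReflect w) t := by
  rw [Fin.sum_univ_castSucc]
  simp only [Fin.snoc_castSucc, Fin.snoc_last]
  rw [weilConv_weilReflect_real_mul]

/-- Appending a test supported in `[-a', a']` to a family of tests supported in `[-a, a] ⊆ [-a', a']` gives a
family of tests supported in `[-a', a']` (the cone hypothesis of the route items, over Mathlib primitives).
[folklore] -/
theorem snoc_family_isWeilTest_tsupport {k : ℕ} {g : Fin k → ℝ → ℂ} {a a' : ℝ} (haa' : a ≤ a')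
    (hg : ∀ i, (ContDiff ℝ ((⊤ : ℕ∞) : WithTop ℕ∞) (g i) ∧ HasCompactSupport (g i)) ∧
      tsupport (g i) ⊆ Set.Icc (-a) a)
    {w : ℝ → ℂ} (hw : IsWeilTest w) (hwsupp : tsupport w ⊆ Set.Icc (-a') a') :
    ∀ i, (ContDiff ℝ ((⊤ : ℕ∞) : WithTop ℕ∞) (Fin.snoc (α := fun _ => ℝ → ℂ) g w i) ∧
        HasCompactSupport (Fin.snoc (α := fun _ => ℝ → ℂ) g w i)) ∧
      tsupport (Fin.snoc (α := fun _ => ℝ → ℂ) g w i) ⊆ Set.Icc (-a') a' := by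
  intro i
  induction i using Fin.lastCases with
  | last =>
    rw [Fin.snoc_last]
    exact ⟨hw, hwsupp⟩
  | cast j =>
    rw [Fin.snoc_castSucc]
    exact ⟨(hg j).1, (hg j).2.trans (Icc_subset_Icc (by linarith) haa')⟩

/-- The autocorrelation sum of tests supported in `[-a, a]` vanishes at every `c > 2a`. [folklore] -/
theorem sum_weilConv_apply_eq_zero_of_lt {k : ℕ} {g : Fin k → ℝ → ℂ} {a c : ℝ}
    (hg : ∀ i, (ContDiff ℝ ((⊤ : ℕ∞) : WithTop ℕ∞) (g i) ∧ HasCompactSupport (g i)) ∧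
      tsupport (g i) ⊆ Set.Icc (-a) a)
    (hc : 2 * a < c) : (∑ i, weilConv (g i) (weilReflect (g i)) c) = 0 := by
  refine Finset.sum_eq_zero fun i _ => ?_
  have hgi : IsWeilTest (g i) := (hg i).1
  have hsub := tsupport_weilConv_weilReflect_subset hgi.2 (hg i).2
  refine image_eq_zero_of_notMem_tsupport fun hmem => ?_
  have := hsub hmem
  rw [mem_Icc] at this
  linarith [this.2]

/-! ## The main theorem -/

/-- **`OscCoherentCore → SignConeInequality`.** The coherent-core child of the oscillatory crux implies the
whole unit-slack sign-cone inequality (the route's target): given a node-nonnegative `F = Σᵢ gᵢ ⋆ g̃ᵢ` at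
cutoff `a`, the family `F + η² (w₁ ⋆ w̃₁) + η² (w₂ ⋆ w̃₂)` (`wⱼ` two-bump witnesses in node gaps at heights
`2a < c₁`, `c₁ + log 2 < c₂`, cutoff `a' = c₂/2 + ρ₂ > 13/10`) is node-nonnegative, negative at `c₁` and at
`c₂` (two heights more than `log 2` apart, so in NO single window `[T, T + log 2]`) for every `η > 0`; the
core at `a'`, linearity of `weilPolarTerm + weilArchTerm`, and `η → 0` give the inequality for `F`.
[folklore] -/
theorem signConeInequality_of_oscCoherentCore : OscCoherentCore → SignConeInequality := by
  intro h a ha k g hg F hn M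
  have hFdef : F = fun t => ∑ i, weilConv (g i) (weilReflect (g i)) t := rfl
  have hgi : ∀ i, IsWeilTest (g i) := fun i => (hg i).1
  have hFt : IsWeilTest F := by
    rw [hFdef]
    exact stub_branchesContinuous_isWeilTest_sum _ fun i _ => (hgi i).weilConv (hgi i).weilReflect
  -- first gap witness, beyond `2a`
  obtain ⟨N₁, c₁, hc₁a, hc₁2, hρc₁, hnode₁, hlogm₁⟩ := exists_gap_parameters ha
  have hρ₁ := (WeilContinuous.bump N₁).rOut_pos
  set ρ₁ := (WeilContinuous.bump N₁).rOut with hρ₁def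
  have hc₁0 : 0 ≤ c₁ := by linarith
  set w₁ : ℝ → ℂ := fun u => WeilContinuous.moll N₁ (u + c₁ / 2) - WeilContinuous.moll N₁ (u - c₁ / 2)
    with hw₁def
  set G₁ : ℝ → ℂ := weilConv w₁ (weilReflect w₁) with hG₁def
  have hw₁t : IsWeilTest w₁ := isWeilTest_twoBump N₁ c₁
  have hw₁supp : tsupport w₁ ⊆ Icc (-(c₁ / 2 + ρ₁)) (c₁ / 2 + ρ₁) := tsupport_twoBump_subset N₁ hc₁0
  have hG₁t : IsWeilTest G₁ := hw₁t.weilConv hw₁t.weilReflect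
  have hG₁node : ∀ m : ℕ, 2 ≤ m → G₁ (Real.log m) = 0 := fun m hm =>
    weilConv_twoBump_eq_zero N₁ hc₁0 (hlogm₁ m hm) (hnode₁ m hm)
  have hG₁c₁ : (G₁ c₁).re < 0 := re_weilConv_twoBump_neg N₁ hρc₁
  -- second gap witness, beyond `c₁ + 2ρ₁ + log 2 + 13/5`
  set a₂ : ℝ := (c₁ + 2 * ρ₁ + Real.log 2) / 2 + 13 / 10 with ha₂def
  have hlog2 : 0 < Real.log 2 := Real.log_pos (by norm_num)
  have ha₂ : 0 < a₂ := by rw [ha₂def]; positivity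
  obtain ⟨N₂, c₂, hc₂a, hc₂2, hρc₂, hnode₂, hlogm₂⟩ := exists_gap_parameters ha₂
  have hρ₂ := (WeilContinuous.bump N₂).rOut_pos
  set ρ₂ := (WeilContinuous.bump N₂).rOut with hρ₂def
  have hc₂0 : 0 ≤ c₂ := by linarith
  have hc₁c₂ : c₁ + 2 * ρ₁ + Real.log 2 + 13 / 5 < c₂ := by rw [ha₂def] at hc₂a; linarith
  have hρ₂2 : 2 * ρ₂ ≤ Real.log 2 := by
    have := hlogm₂ 2 le_rfl
    push_cast at this
    exact this
  set w₂ : ℝ → ℂ := fun u => WeilContinuous.moll N₂ (u + c₂ / 2) - WeilContinuous.moll N₂ (u - c₂ / 2)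
    with hw₂def
  set G₂ : ℝ → ℂ := weilConv w₂ (weilReflect w₂) with hG₂def
  have hw₂t : IsWeilTest w₂ := isWeilTest_twoBump N₂ c₂
  have hw₂supp : tsupport w₂ ⊆ Icc (-(c₂ / 2 + ρ₂)) (c₂ / 2 + ρ₂) := tsupport_twoBump_subset N₂ hc₂0
  have hG₂t : IsWeilTest G₂ := hw₂t.weilConv hw₂t.weilReflect
  have hG₂node : ∀ m : ℕ, 2 ≤ m → G₂ (Real.log m) = 0 := fun m hm =>
    weilConv_twoBump_eq_zero N₂ hc₂0 (hlogm₂ m hm) (hnode₂ m hm)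
  have hG₂c₂ : (G₂ c₂).re < 0 := re_weilConv_twoBump_neg N₂ hρc₂
  -- cross vanishing: `G₁ c₂ = 0`, `G₂ c₁ = 0`
  have hG₁c₂ : G₁ c₂ = 0 := by
    refine weilConv_twoBump_eq_zero N₁ hc₁0 (by linarith) ?_
    rw [abs_of_nonneg (by linarith)]
    linarith
  have hG₂c₁ : G₂ c₁ = 0 := by
    refine weilConv_twoBump_eq_zero N₂ hc₂0 (by linarith) ?_
    rw [abs_of_nonpos (by linarith)]
    linarith
  -- `F` vanishes at `c₁, c₂ > 2a`
  have hFc₁ : F c₁ = 0 := sum_weilConv_apply_eq_zero_of_lt hg hc₁a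
  have hFc₂ : F c₂ = 0 := sum_weilConv_apply_eq_zero_of_lt hg (by linarith)
  -- the key inequality for every `η > 0`
  have key : ∀ η : ℝ, 0 < η →
      -(F 0).re ≤ (weilPolarTerm F + weilArchTerm F).re +
        η ^ 2 * ((weilPolarTerm G₁ + weilArchTerm G₁).re + (G₁ 0).re +
          ((weilPolarTerm G₂ + weilArchTerm G₂).re + (G₂ 0).re)) := by
    intro η hη
    set a' : ℝ := c₂ / 2 + ρ₂ with ha'def
    have ha' : 0 < a' := by rw [ha'def]; linarith
    have ha'13 : 13 / 10 < a' := by rw [ha'def]; linarith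
    have haa' : a ≤ a' := by rw [ha'def]; linarith
    have h1a' : c₁ / 2 + ρ₁ ≤ a' := by rw [ha'def]; linarith
    -- the scaled witnesses
    set v₁ : ℝ → ℂ := fun u => (η : ℂ) * w₁ u with hv₁def
    set v₂ : ℝ → ℂ := fun u => (η : ℂ) * w₂ u with hv₂def
    have hv₁t : IsWeilTest v₁ := hw₁t.const_mul (η : ℂ)
    have hv₂t : IsWeilTest v₂ := hw₂t.const_mul (η : ℂ)
    have hv₁supp : tsupport v₁ ⊆ Icc (-a') a' :=
      (tsupport_mul_subset_right.trans hw₁supp).trans (Icc_subset_Icc (by linarith) h1a')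
    have hv₂supp : tsupport v₂ ⊆ Icc (-a') a' := tsupport_mul_subset_right.trans hw₂supp
    -- the extended family `g'' = (g, η w₁, η w₂)`
    set g' : Fin (k + 1) → ℝ → ℂ := Fin.snoc (α := fun _ => ℝ → ℂ) g v₁ with hg'def
    set g'' : Fin (k + 2) → ℝ → ℂ := Fin.snoc (α := fun _ => ℝ → ℂ) g' v₂ with hg''def
    have hg' : ∀ i, (ContDiff ℝ ((⊤ : ℕ∞) : WithTop ℕ∞) (g' i) ∧ HasCompactSupport (g' i)) ∧
        tsupport (g' i) ⊆ Set.Icc (-a') a' :=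
      snoc_family_isWeilTest_tsupport haa' hg hv₁t hv₁supp
    have hg'' : ∀ i, (ContDiff ℝ ((⊤ : ℕ∞) : WithTop ℕ∞) (g'' i) ∧ HasCompactSupport (g'' i)) ∧
        tsupport (g'' i) ⊆ Set.Icc (-a') a' :=
      snoc_family_isWeilTest_tsupport le_rfl hg' hv₂t hv₂supp
    -- its autocorrelation sum is `F + η² G₁ + η² G₂`
    set F₁ : ℝ → ℂ := fun t => F t + ((η ^ 2 : ℝ) : ℂ) * G₁ t with hF₁def
    have hF₁t : IsWeilTest F₁ := hFt.add (hG₁t.const_mul _)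
    have hF''t : ∀ t, ∑ i, weilConv (g'' i) (weilReflect (g'' i)) t =
        F₁ t + ((η ^ 2 : ℝ) : ℂ) * G₂ t := by
      intro t
      rw [hg''def, hv₂def, sum_weilConv_snoc_const_mul_apply, hg'def, hv₁def,
        sum_weilConv_snoc_const_mul_apply]
      rfl
    have hF'' : (fun t => ∑ i, weilConv (g'' i) (weilReflect (g'' i)) t) =
        fun t => F₁ t + ((η ^ 2 : ℝ) : ℂ) * G₂ t := funext hF''t
    -- node non-negativity
    have hn'' : ∀ m : ℕ, 2 ≤ m →
        0 ≤ ((fun t => ∑ i, weilConv (g'' i) (weilReflect (g'' i)) t) (Real.log m)).re := by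
      intro m hm
      show 0 ≤ (∑ i, weilConv (g'' i) (weilReflect (g'' i)) (Real.log m)).re
      rw [hF''t, hF₁def]
      simp only [hG₁node m hm, hG₂node m hm, mul_zero, add_zero]
      exact hn m hm
    -- the values at `c₁` and `c₂`
    have hre₁ : ((fun t => ∑ i, weilConv (g'' i) (weilReflect (g'' i)) t) c₁).re < 0 := by
      show (∑ i, weilConv (g'' i) (weilReflect (g'' i)) c₁).re < 0
      rw [hF''t, hF₁def]
      simp only [hFc₁, hG₂c₁, zero_add, mul_zero, add_zero, Complex.re_ofReal_mul]
      exact mul_neg_of_pos_of_neg (pow_pos hη 2) hG₁c₁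
    have hre₂ : ((fun t => ∑ i, weilConv (g'' i) (weilReflect (g'' i)) t) c₂).re < 0 := by
      show (∑ i, weilConv (g'' i) (weilReflect (g'' i)) c₂).re < 0
      rw [hF''t, hF₁def]
      simp only [hFc₂, hG₁c₂, zero_add, mul_zero, Complex.re_ofReal_mul]
      exact mul_neg_of_pos_of_neg (pow_pos hη 2) hG₂c₂
    have habs₁ : Real.log 2 ≤ |c₁| := by rwa [abs_of_nonneg hc₁0]
    have habs₂ : Real.log 2 ≤ |c₂| := by rwa [abs_of_nonneg hc₂0]
    -- oscillation, and NOT a single window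
    have hosc'' : ∃ t : ℝ, Real.log 2 ≤ |t| ∧
        ((fun t => ∑ i, weilConv (g'' i) (weilReflect (g'' i)) t) t).re < 0 := ⟨c₁, habs₁, hre₁⟩
    have hnw'' : ¬ ∃ T : ℝ, 3 ≤ T ∧ ∀ t : ℝ, Real.log 2 ≤ |t| →
        ((fun t => ∑ i, weilConv (g'' i) (weilReflect (g'' i)) t) t).re < 0 →
          T ≤ |t| ∧ |t| ≤ T + Real.log 2 := by
      rintro ⟨T, -, hT⟩
      have h₁ := hT c₁ habs₁ hre₁
      have h₂ := hT c₂ habs₂ hre₂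
      rw [abs_of_nonneg hc₁0] at h₁
      rw [abs_of_nonneg hc₂0] at h₂
      linarith [h₁.1, h₂.2]
    have step : -((fun t => ∑ i, weilConv (g'' i) (weilReflect (g'' i)) t) 0).re ≤
        (weilPolarTerm (fun t => ∑ i, weilConv (g'' i) (weilReflect (g'' i)) t) +
          weilArchTerm (fun t => ∑ i, weilConv (g'' i) (weilReflect (g'' i)) t)).re :=
      h a' ha' ha'13 (k + 2) g'' hg'' hn'' hnw'' hosc''
    have e₁ : weilPolarTerm F₁ + weilArchTerm F₁ =
        (weilPolarTerm F + weilArchTerm F) + ((η ^ 2 : ℝ) : ℂ) * (weilPolarTerm G₁ + weilArchTerm G₁) :=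
      weilArchPolar_add_const_mul hFt hG₁t _
    rw [hF'', weilArchPolar_add_const_mul hF₁t hG₂t, e₁] at step
    simp only [hF₁def, Complex.add_re, Complex.re_ofReal_mul] at step
    simp only [Complex.add_re]
    linear_combination step
  exact le_of_forall_pos_le_add_sq_mul key

/-! ## Corollaries: the core is the crux, the target, and implies its siblings -/

/-- **`OscCoherentCore → SignConeOscillatory`**: the coherent-core child implies the whole oscillatory crux
(item stmt-RiemannHypothesis-16302). [folklore] -/
theorem signConeOscillatory_of_oscCoherentCore (h : OscCoherentCore) : SignConeOscillatory :=
  signConeOscillatory_of_signConeInequality (signConeInequality_of_oscCoherentCore h)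

/-- `SignConeOscillatory → OscCoherentCore` (the core is a restriction of the crux). [folklore] -/
theorem oscCoherentCore_of_signConeOscillatory (h : SignConeOscillatory) : OscCoherentCore :=
  fun a ha _ k g hg hn _ hosc => h a ha k g hg hn hosc

/-- **The core is the crux**: `OscCoherentCore ↔ SignConeOscillatory`. [folklore] -/
theorem oscCoherentCore_iff_signConeOscillatory : OscCoherentCore ↔ SignConeOscillatory :=
  ⟨signConeOscillatory_of_oscCoherentCore, oscCoherentCore_of_signConeOscillatory⟩

/-- **The core is the target**: `OscCoherentCore ↔ SignConeInequality`. [folklore] -/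
theorem oscCoherentCore_iff_signConeInequality : OscCoherentCore ↔ SignConeInequality :=
  ⟨signConeInequality_of_oscCoherentCore,
    fun h => oscCoherentCore_of_signConeOscillatory (signConeOscillatory_of_signConeInequality h)⟩

/-- `SignConeOscillatory → OscSingleWindow` (the single-window child is a restriction of the crux).
[folklore] -/
theorem oscSingleWindow_of_signConeOscillatory (h : SignConeOscillatory) : OscSingleWindow :=
  fun a ha k g hg hn _ hosc => h a ha k g hg hn hosc

/-- **The core implies its sibling**: `OscCoherentCore → OscSingleWindow` — in the rev-5 deciding theorem
`closes hR hS hC …` the single-window hypothesis `hS` (and the certified rung `hR`) are implied by the core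
`hC`. [folklore] -/
theorem oscSingleWindow_of_oscCoherentCore (h : OscCoherentCore) : OscSingleWindow :=
  oscSingleWindow_of_signConeOscillatory (signConeOscillatory_of_oscCoherentCore h)

/-- `SignConeOscillatory → OscUpToThirteenTenths` (the certified rung is a restriction of the crux; it is
also landed unconditionally as `signConeOscillatory_upTo_thirteen_tenths`). [folklore] -/
theorem oscUpToThirteenTenths_of_signConeOscillatory (h : SignConeOscillatory) : OscUpToThirteenTenths :=
  fun a ha _ k g hg hn hosc => h a ha k g hg hn hosc

/-- **The core is the far-field item too**: `OscCoherentCore → SignConeFarField`. [folklore] -/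
theorem signConeFarField_of_oscCoherentCore (h : OscCoherentCore) : SignConeFarField :=
  signConeFarField_of_signConeInequality (signConeInequality_of_oscCoherentCore h)

/-- **RH ⇒ the core** (consistency: the core is RH-implied, as every item of the sign cone).
[folklore] -/
theorem oscCoherentCore_of_riemannHypothesis (hRH : RiemannHypothesis) : OscCoherentCore :=
  oscCoherentCore_of_signConeOscillatory (signConeOscillatory_of_riemannHypothesis hRH)

end Summit.RiemannHypothesis.RiemannHypothesis.Theorems.SignCone

end
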